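/-
Copyright (c) 2026 the pub-hodgecm-mathlib formalisation cell (harness21).  Prover seat hodgecm-mathlib-LH4-p12 (g7), req620 Track A «(D-RAM) FOUR-FRAME», line LH4
(STAGE-1b tier-0 regular row, (L-sq) producer (S2b-T) «THE LABELLED TRUNK», split part: the four LABELLED type-0 κ-SOCKETS on the split strata core ∕ T1 ∕ T2 ∕ T3 —
★ (LH4-p05) `F0P3cDyRamDiagonalKappaSplitCountSockets` cut by a level label, the label being CONSTANT on each split stratum by ★ LH4-p09 `F0P3cDyRamLabelledSplitStrata`).  2026-09-04.
-/
import Summits.HodgeConjecture.HodgeConjecture.Theorems.F0P3cDyRamDiagonalKappaSplitCountSockets   -- ★ (LH4-p05): the four unlabelled type-0 κ-sockets core ∕ T1 ∕ T2 ∕ T3, `hasAxis_axis1∕2∕3_iff`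
import Summits.HodgeConjecture.HodgeConjecture.Theorems.F0P3cDyRamLabelledSplitStrata             -- ★ (LH4-p09 (g8)): `latticeInLevel_diagonal_latt_T1∕T2∕T3_iff`, `finsum_mem_sep_eq_ite_of_forall_iff`
import HarnessLib

/-!
# Crux `H413`, line LH4 «(D-RAM) FOUR-FRAME» — (S2b-T), split part: THE FOUR LABELLED TYPE-0 κ-SOCKETS ON THE SPLIT STRATA

The LABELLED TRUNK of the (L-sq) square κ-sign law (the one open input of ★ p859650
`F0P3cDyRamSqKappaSignCount2TypeZeroOfLabelledTrunk.kappaSignCount2_typeZero_sep_of_labelledTrunk`) is ★ TRUNK p857082's assembly with the level label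
`LatticeInLevel ϖ ℓ (diag e)` riding along: the summation set `{M ∈ 𝓛₀(T) | dualisable ∧ label}` is partitioned by axis into the LABEL-CUT strata
`{M ∈ stratum σ ϖ T a | LatticeInLevel ϖ ℓ (diag e) M}`, and each cut stratum needs its κ-weighted census in closed form.  On the four SPLIT families — core `(0,0,0)`,
`T1 (0,s,s)`, `T2 (s,0,s)`, `T3 (s,s,0)` — every member is an explicit one-parameter HNF lattice (★ `hasAxis_axis1∕2∕3_iff`) on which the label is a CONSTANT condition in
`(ℓ, s, |e_i|, |e_j − e_k|)` (★ LH4-p09 `latticeInLevel_diagonal_latt_T1∕T2∕T3_iff`), so the labelled κ-socket is the unlabelled ★ κ-socket times that indicator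
(★ LH4-p09 `finsum_mem_sep_eq_ite_of_forall_iff`); the core cut is `0` like the core itself (its only member is `𝒪³`, where `κ₀ = 0`).

* `finsum_kappaCount_mul_stabiliserWeight_stratum_core_sep_latticeInLevel` — labelled κ-core: `0`.
* `finsum_kappaCount_mul_stabiliserWeight_stratum_T1_sep_latticeInLevel` — labelled κ-T1: `[label(ℓ,s,e)] · [i = 0 ∧ 2d ≤ s ∧ 2 ∣ s ∧ s ≤ n₁] · ω(−1) · q^{s∕2}`.
* `finsum_kappaCount_mul_stabiliserWeight_stratum_T2_sep_latticeInLevel` — labelled κ-T2: the same at slot 1 ∕ `n₂` ∕ `|e₂ − e₀|`.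
* `finsum_kappaCount_mul_stabiliserWeight_stratum_T3_sep_latticeInLevel` — labelled κ-T3: the same at slot 2 ∕ `n₃` ∕ `|e₁ − e₀|`.

The glued families G1 ∕ G2 ∕ G3 and the core-hanging family H are NOT constant-label strata on the cancellation locus (★ LH4-p09 `latticeInLevel_diagonal_latt_G1_iff`: the mixed
term `x·ζ·(e₂ − e₁) + (e₂ − e₀)·y''`) — their labelled κ-sockets are separate files.

HONEST LABEL: helper lane (`--supports stmt-HodgeConjecture-24833`), count-neutral; four per-stratum census identities in diagonal-model currency; pays no tier-0 row by
itself (T₊∕T₋∕reg OPEN; the labelled trunk stays OPEN until the glued ∕ hanging labelled κ-sockets and the labelled κ-box-sum land); HC_CM is proved only modulo the 7 printed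
citations (2 remaining named inputs: hLiu418 = stmt-HodgeConjecture-24832, h413 = stmt-HodgeConjecture-24833) until rung 0 closes.

## References (NEVER `[KR2]`)
* [Kottwitz1986BaseChangeUnits] R. E. Kottwitz, *Base change for unit elements of Hecke algebras*, Compositio Math. 60 (1986), §1 pp. 240–241.
* [Rogawski1990] J. D. Rogawski, *Automorphic Representations of Unitary Groups in Three Variables*, Ann. of Math. Stud. 123 (1990), §4.9 Prop. 4.9.1 (a) p. 55.
* [LanglandsShelstad1987] R. P. Langlands, D. Shelstad, *On the definition of transfer factors*, Math. Ann. 278 (1987), §3.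
* [Serre1980Trees] J.-P. Serre, *Trees*, Springer (1980), Ch. II §1.1.
-/

set_option autoImplicit false

noncomputable section

namespace Summit.HodgeConjecture.HodgeConjecture.Cruxes.H413.F0P3cDyRamLabelledKappaSplitSockets

open Matrix
open Literature.NumberTheory.Automorphic Literature.NumberTheory.Automorphic.HermitianLattice
open Literature.NumberTheory.Automorphic.UnitaryLatticeTree Literature.NumberTheory.Automorphic.UnitaryThreeFourFrame
open Literature.NumberTheory.LocalFields Literature.NumberTheory.LocalFields.WildQuadraticDatum
open Summit.HodgeConjecture.HodgeConjecture.Cruxes.H413.F0P3cDyRamDiagonalTorusDefs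
open Summit.HodgeConjecture.HodgeConjecture.Cruxes.H413.F0P3cDyRamDiagonalStrataDefs
open Summit.HodgeConjecture.HodgeConjecture.Cruxes.H413.F0P3cDyRamDiagonalKappaCountDefs
open Summit.HodgeConjecture.HodgeConjecture.Cruxes.H413.F0P3cDyRamDiagonalSplitCount
open Summit.HodgeConjecture.HodgeConjecture.Cruxes.H413.F0P3cDyRamDiagonalSplitCountSockets
open Summit.HodgeConjecture.HodgeConjecture.Cruxes.H413.F0P3cDyRamDiagonalKappaSplitCountValues
open Summit.HodgeConjecture.HodgeConjecture.Cruxes.H413.F0P3cDyRamDiagonalKappaSplitCountSockets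
open Summit.HodgeConjecture.HodgeConjecture.Cruxes.H413.F0P3cDyRamFourFrameCensusDefs
open Summit.HodgeConjecture.HodgeConjecture.Cruxes.H413.F0P3cDyRamLabelledSplitStrata
open scoped Valued WithZero Matrix MatrixGroups

variable {K : Type} [Field K] [Valued K ℤᵐ⁰] [Fintype 𝓀[K]] [CompleteSpace K] {σ : K →+* K} {ϖ : K} {d t : ℕ} {α β : K} {N₀ n₁ n₂ n₃ : ℕ}
  {T : GL (Fin 3) K}

/-- **LABELLED κ-CORE**: `Σᶠ_{M ∈ stratum (0,0,0), diag(e)·M ⊆ ϖ^ℓ·M} κ₀,ᵢ(M)·w(M) = 0` — the core stratum is `{𝒪³}` (as in ★ `finsum_kappaCount_mul_stabiliserWeight_hasAxis_core`) and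
`κ₀,ᵢ(𝒪³) = 0` (★ `kappaCount_zero_stdLattice`), whatever the label. [cite: Kottwitz1986BaseChangeUnits, §1 pp. 240–241] [cite: Rogawski1990, §4.9 Prop. 4.9.1 (a) p. 55] -/
theorem finsum_kappaCount_mul_stabiliserWeight_stratum_core_sep_latticeInLevel (hD : IsRamifiedQuadraticDatum σ ϖ d t)
    (_hE : IsElementDatum σ ϖ N₀ α β n₁ n₂ n₃) (_hT : (T : Matrix (Fin 3) (Fin 3) K) = Matrix.diagonal ![α, β, 1]) (i : Fin 3) (ℓ : ℕ) (e : Fin 3 → K) :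
    ∑ᶠ M ∈ {M | M ∈ stratum σ ϖ T ![0, 0, 0] ∧ LatticeInLevel ϖ ℓ (Matrix.diagonal e) M}, (kappaCount σ ϖ 0 i M : ℚ) * stabiliserWeight σ M = 0 := by
  have hD' := hD
  obtain ⟨-, -, hϖ, -, -, -, -⟩ := hD'
  haveI : IsAdicComplete 𝓂[K] 𝒪[K] := isAdicComplete_valuedInteger_of_completeSpace hϖ
  -- a member of the core stratum is `𝒪³` (verbatim the argument of ★ `finsum_kappaCount_mul_stabiliserWeight_hasAxis_core`)
  have hroot : ∀ M ∈ stratum σ ϖ T ![0, 0, 0], M = stdLattice K 3 := by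
    rintro M ⟨⟨-, -, hN⟩, -, hax⟩
    refine le_antisymm (fun w hw => mem_stdLattice.2 fun j => (hN j).1 w hw) (fun w hw => ?_)
    have hw' : ∀ j, Valued.v (w j) ≤ 1 := fun j => mem_stdLattice.1 hw j
    rw [← Finset.univ_sum_single w]
    refine M.sum_mem fun k _ => ?_
    have e0 : ((![0, 0, 0] : Fin 3 → ℕ) k) = 0 := by fin_cases k <;> rfl
    have hk : (Pi.single k (1 : K) : Fin 3 → K) ∈ M := (hax k 1).2 (by rw [e0, pow_zero, map_one])
    have hmem := M.smul_mem (⟨w k, hw' k⟩ : 𝒪[K]) hk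
    have heq : ((⟨w k, hw' k⟩ : 𝒪[K]) • (Pi.single k (1 : K) : Fin 3 → K)) = Pi.single k (w k) := by
      change (w k : K) • (Pi.single k (1 : K) : Fin 3 → K) = Pi.single k (w k)
      rw [← Pi.single_smul, smul_eq_mul, mul_one]
    rwa [heq] at hmem
  have hκ : ∀ M ∈ {M | M ∈ stratum σ ϖ T ![0, 0, 0] ∧ LatticeInLevel ϖ ℓ (Matrix.diagonal e) M},
      (kappaCount σ ϖ 0 i M : ℚ) * stabiliserWeight σ M = 0 := fun M hM => by
    rw [hroot M hM.1, kappaCount_zero_stdLattice hD i, Int.cast_zero, zero_mul]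
  rw [finsum_mem_congr rfl hκ]
  simp

/-- **LABELLED κ-T1 `(0,s,s)`** (`s ≥ 1`): `Σᶠ_{M ∈ stratum (0,s,s), diag(e)·M ⊆ ϖ^ℓ·M} κ₀,ᵢ(M)·w(M) = ω(−1)·q^{s∕2}` if `i = 0 ∧ 2d ≤ s ∧ 2 ∣ s ∧ s ≤ n₁` AND the label condition
`(∀ j, |e_j| ≤ |ϖ|^ℓ) ∧ |e₂ − e₁| ≤ |ϖ|^{ℓ+s}` holds, else `0` — ★ `finsum_kappaCount_mul_stabiliserWeight_hasAxis_T1` cut by a label constant on the stratum (★ LH4-p09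
`latticeInLevel_diagonal_latt_T1_iff` on `M₁(s,z)`, ★ `hasAxis_axis1_iff`). [cite: Kottwitz1986BaseChangeUnits, §1 pp. 240–241] [cite: Rogawski1990, §4.9 Prop. 4.9.1 (a) p. 55]
[cite: LanglandsShelstad1987, §3] -/
theorem finsum_kappaCount_mul_stabiliserWeight_stratum_T1_sep_latticeInLevel (hD : IsRamifiedQuadraticDatum σ ϖ d t)
    (hE : IsElementDatum σ ϖ N₀ α β n₁ n₂ n₃) (hT : (T : Matrix (Fin 3) (Fin 3) K) = Matrix.diagonal ![α, β, 1]) (s : ℕ) (hs : 1 ≤ s) (i : Fin 3)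
    (ℓ : ℕ) (e : Fin 3 → K) :
    ∑ᶠ M ∈ {M | M ∈ stratum σ ϖ T ![0, s, s] ∧ LatticeInLevel ϖ ℓ (Matrix.diagonal e) M}, (kappaCount σ ϖ 0 i M : ℚ) * stabiliserWeight σ M =
      if ((Valued.v (e 0) ≤ Valued.v ϖ ^ ℓ ∧ Valued.v (e 1) ≤ Valued.v ϖ ^ ℓ ∧ Valued.v (e 2) ≤ Valued.v ϖ ^ ℓ) ∧
          Valued.v (e 2 - e 1) ≤ Valued.v ϖ ^ (ℓ + s)) then
        (if i = 0 ∧ 2 * d ≤ s ∧ 2 ∣ s ∧ s ≤ n₁ then (normSign σ (-1 : K) : ℚ) * (Fintype.card 𝓀[K] : ℚ) ^ (s / 2) else 0) else 0 := by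
  classical
  have hϖ : Valued.v ϖ = WithZero.exp (-1 : ℤ) := hD.2.2.1
  have hϖ0 : ϖ ≠ 0 := fun h0 => by rw [h0, map_zero] at hϖ; exact WithZero.coe_ne_zero hϖ.symm
  rw [finsum_mem_sep_eq_ite_of_forall_iff (stratum σ ϖ T ![0, s, s]) _ _ (fun M hM => by
    obtain ⟨z, hz, rfl⟩ := (hasAxis_axis1_iff hϖ hM.1 hs).1 hM.2.2
    exact latticeInLevel_diagonal_latt_T1_iff hϖ0 ℓ s e hz), finsum_kappaCount_mul_stabiliserWeight_hasAxis_T1 hD hE hT s hs i]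

/-- **LABELLED κ-T2 `(s,0,s)`** (`s ≥ 1`): `ω(−1)·q^{s∕2}` if `i = 1 ∧ 2d ≤ s ∧ 2 ∣ s ∧ s ≤ n₂` AND `(∀ j, |e_j| ≤ |ϖ|^ℓ) ∧ |e₂ − e₀| ≤ |ϖ|^{ℓ+s}`, else `0`
(★ `finsum_kappaCount_mul_stabiliserWeight_hasAxis_T2`, ★ LH4-p09 `latticeInLevel_diagonal_latt_T2_iff`, ★ `hasAxis_axis2_iff`). [cite: Kottwitz1986BaseChangeUnits, §1 pp. 240–241]
[cite: Rogawski1990, §4.9 Prop. 4.9.1 (a) p. 55] [cite: LanglandsShelstad1987, §3] -/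
theorem finsum_kappaCount_mul_stabiliserWeight_stratum_T2_sep_latticeInLevel (hD : IsRamifiedQuadraticDatum σ ϖ d t)
    (hE : IsElementDatum σ ϖ N₀ α β n₁ n₂ n₃) (hT : (T : Matrix (Fin 3) (Fin 3) K) = Matrix.diagonal ![α, β, 1]) (s : ℕ) (hs : 1 ≤ s) (i : Fin 3)
    (ℓ : ℕ) (e : Fin 3 → K) :
    ∑ᶠ M ∈ {M | M ∈ stratum σ ϖ T ![s, 0, s] ∧ LatticeInLevel ϖ ℓ (Matrix.diagonal e) M}, (kappaCount σ ϖ 0 i M : ℚ) * stabiliserWeight σ M =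
      if ((Valued.v (e 0) ≤ Valued.v ϖ ^ ℓ ∧ Valued.v (e 1) ≤ Valued.v ϖ ^ ℓ ∧ Valued.v (e 2) ≤ Valued.v ϖ ^ ℓ) ∧
          Valued.v (e 2 - e 0) ≤ Valued.v ϖ ^ (ℓ + s)) then
        (if i = 1 ∧ 2 * d ≤ s ∧ 2 ∣ s ∧ s ≤ n₂ then (normSign σ (-1 : K) : ℚ) * (Fintype.card 𝓀[K] : ℚ) ^ (s / 2) else 0) else 0 := by
  classical
  have hϖ : Valued.v ϖ = WithZero.exp (-1 : ℤ) := hD.2.2.1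
  have hϖ0 : ϖ ≠ 0 := fun h0 => by rw [h0, map_zero] at hϖ; exact WithZero.coe_ne_zero hϖ.symm
  rw [finsum_mem_sep_eq_ite_of_forall_iff (stratum σ ϖ T ![s, 0, s]) _ _ (fun M hM => by
    obtain ⟨y, hy, rfl⟩ := (hasAxis_axis2_iff hϖ hM.1 hs).1 hM.2.2
    exact latticeInLevel_diagonal_latt_T2_iff hϖ0 ℓ s e hy), finsum_kappaCount_mul_stabiliserWeight_hasAxis_T2 hD hE hT s hs i]

/-- **LABELLED κ-T3 `(s,s,0)`** (`s ≥ 1`): `ω(−1)·q^{s∕2}` if `i = 2 ∧ 2d ≤ s ∧ 2 ∣ s ∧ s ≤ n₃` AND `(∀ j, |e_j| ≤ |ϖ|^ℓ) ∧ |e₁ − e₀| ≤ |ϖ|^{ℓ+s}`, else `0`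
(★ `finsum_kappaCount_mul_stabiliserWeight_hasAxis_T3`, ★ LH4-p09 `latticeInLevel_diagonal_latt_T3_iff`, ★ `hasAxis_axis3_iff`). [cite: Kottwitz1986BaseChangeUnits, §1 pp. 240–241]
[cite: Rogawski1990, §4.9 Prop. 4.9.1 (a) p. 55] [cite: LanglandsShelstad1987, §3] -/
theorem finsum_kappaCount_mul_stabiliserWeight_stratum_T3_sep_latticeInLevel (hD : IsRamifiedQuadraticDatum σ ϖ d t)
    (hE : IsElementDatum σ ϖ N₀ α β n₁ n₂ n₃) (hT : (T : Matrix (Fin 3) (Fin 3) K) = Matrix.diagonal ![α, β, 1]) (s : ℕ) (hs : 1 ≤ s) (i : Fin 3)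
    (ℓ : ℕ) (e : Fin 3 → K) :
    ∑ᶠ M ∈ {M | M ∈ stratum σ ϖ T ![s, s, 0] ∧ LatticeInLevel ϖ ℓ (Matrix.diagonal e) M}, (kappaCount σ ϖ 0 i M : ℚ) * stabiliserWeight σ M =
      if ((Valued.v (e 0) ≤ Valued.v ϖ ^ ℓ ∧ Valued.v (e 1) ≤ Valued.v ϖ ^ ℓ ∧ Valued.v (e 2) ≤ Valued.v ϖ ^ ℓ) ∧
          Valued.v (e 1 - e 0) ≤ Valued.v ϖ ^ (ℓ + s)) then
        (if i = 2 ∧ 2 * d ≤ s ∧ 2 ∣ s ∧ s ≤ n₃ then (normSign σ (-1 : K) : ℚ) * (Fintype.card 𝓀[K] : ℚ) ^ (s / 2) else 0) else 0 := by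
  classical
  have hϖ : Valued.v ϖ = WithZero.exp (-1 : ℤ) := hD.2.2.1
  have hϖ0 : ϖ ≠ 0 := fun h0 => by rw [h0, map_zero] at hϖ; exact WithZero.coe_ne_zero hϖ.symm
  rw [finsum_mem_sep_eq_ite_of_forall_iff (stratum σ ϖ T ![s, s, 0]) _ _ (fun M hM => by
    obtain ⟨x, hx, rfl⟩ := (hasAxis_axis3_iff hϖ hM.1 hs).1 hM.2.2
    exact latticeInLevel_diagonal_latt_T3_iff hϖ0 ℓ s e hx), finsum_kappaCount_mul_stabiliserWeight_hasAxis_T3 hD hE hT s hs i]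

end Summit.HodgeConjecture.HodgeConjecture.Cruxes.H413.F0P3cDyRamLabelledKappaSplitSockets

end
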